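import Mathlib
import HarnessLib
import Summits.CriticalPhenomena.Ising3DConformalLimit.Theses.ModularBoosts

/-!
# `EllipsoidToSphere` — the speed lemma (V) of route ModularBoosts
(support item stmt-CriticalPhenomena-5432: PROOF of
`Summit.CriticalPhenomena.Ising3DConformalLimit.Theses.ModularBoosts.EllipsoidToSphere`)

Statement (V): if `S : CorrFamily 3` has a positive two-point function on `NonCoincident 3 2`, is scale
covariant with exponent `Δ > 0`, is invariant under the coordinate swap `x₀ ↔ x₂`
(`LinearIsometryEquiv.piLpCongrLeft 2 ℝ ℝ (Equiv.swap 0 2)`) and under every linear map of `ℝ³`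
preserving the quadratic form `Q_v(z) = z₀² + z₁² + v² z₂²` (`v > 0`), then `S` is `O(3)`-invariant
(`IsRotationInvariant S`).

Proof (pure linear algebra, exactly the item's docstring).  Let `A_v (z₀,z₁,z₂) = (-v z₂, z₁, z₀/v)` — the
quarter turn `e₀ ↦ e₂ ↦ -e₀` of the `(0,2)`-plane conjugated by `D = diag(1,1,v)`; it preserves `Q_v`, so
every `S n` is `A_v`-invariant.  With the swap `P` (also an invariance of every `S n`) the composite
`M = A_v ∘ P ∘ A_v ∘ P` is `diag(v², 1, v⁻²)`; on the non-coincident pair `x = (e₀, 2e₀)` it acts as the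
dilation by `v²`, whence `S 2 x = S 2 (M x) = (v²)^(-2Δ) S 2 x` by scale covariance.  Positivity of
`S 2 x` forces `(v²)^(-2Δ) = 1`, i.e. `v = 1` because `Δ > 0`.  For `v = 1` the form `Q_1` is the squared
Euclidean norm, preserved by every linear isometry, so the ellipsoidal hypothesis IS `O(3)`-invariance.

References: P. Di Francesco, P. Mathieu, D. Sénéchal, *Conformal Field Theory* (Springer 1997), §4.3.1
eq. (4.62) (scale covariance of quasi-primary correlators — the tree's `IsScaleCovariant`); R. Haag,
*Local Quantum Physics* (2nd ed., Springer 1996), §I.2.1 (invariance groups of quadratic forms; the only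
input used is that `O(Q_v)` together with the coordinate swap generates a genuine dilation unless `v = 1`).
Nothing here is specific to the Ising model.  No definitions are introduced: `A_v` is the
`Matrix.toEuclideanLin` of the explicit matrix `!![0, 0, -v; 0, 1, 0; v⁻¹, 0, 0]`, packaged with its two
properties in `quarterTurn_spec`.
-/

noncomputable section

namespace Summit.CriticalPhenomena.Ising3DConformalLimit.ModularBoostsSpeed

open Literature.Probability.LatticeModels
open Summit.CriticalPhenomena.Ising3DConformalLimit.Theses.ModularBoosts

/-! ### Coordinates on `ℝ³`: matrices, the swap, the test pair, the conjugated quarter turn -/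

/-- Coordinates of `Matrix.toEuclideanLin M z` on `ℝ³`: `(M z)_j = Σ_k M_{jk} z_k`. [folklore] -/
theorem toEuclideanLin_coord (M : Matrix (Fin 3) (Fin 3) ℝ) (z : EuclideanSpace ℝ (Fin 3)) (j : Fin 3) :
    Matrix.toEuclideanLin M z j = ∑ k, M j k * z k := by
  simp [Matrix.toEuclideanLin, Matrix.toLpLin_apply, Matrix.mulVec, dotProduct]

/-- `A_v` in coordinates: `(A_v z)₀ = -v z₂`, for the conjugated quarter turn
`A_v = Matrix.toEuclideanLin !![0, 0, -v; 0, 1, 0; v⁻¹, 0, 0]`. [folklore] -/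
@[simp] theorem quarterTurn_apply_zero (v : ℝ) (z : EuclideanSpace ℝ (Fin 3)) :
    Matrix.toEuclideanLin !![(0 : ℝ), 0, -v; 0, 1, 0; v⁻¹, 0, 0] z 0 = -v * z 2 := by
  rw [toEuclideanLin_coord]; simp [Fin.sum_univ_three]

/-- `A_v` in coordinates: `(A_v z)₁ = z₁`. [folklore] -/
@[simp] theorem quarterTurn_apply_one (v : ℝ) (z : EuclideanSpace ℝ (Fin 3)) :
    Matrix.toEuclideanLin !![(0 : ℝ), 0, -v; 0, 1, 0; v⁻¹, 0, 0] z 1 = z 1 := by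
  rw [toEuclideanLin_coord]; simp [Fin.sum_univ_three]

/-- `A_v` in coordinates: `(A_v z)₂ = z₀ / v`. [folklore] -/
@[simp] theorem quarterTurn_apply_two (v : ℝ) (z : EuclideanSpace ℝ (Fin 3)) :
    Matrix.toEuclideanLin !![(0 : ℝ), 0, -v; 0, 1, 0; v⁻¹, 0, 0] z 2 = v⁻¹ * z 0 := by
  rw [toEuclideanLin_coord]; simp [Fin.sum_univ_three]

/-- The coordinate swap `x₀ ↔ x₂` of `ℝ³` in coordinates: `(P w)₀ = w₂`. [folklore] -/
@[simp] theorem swap_apply_zero (w : EuclideanSpace ℝ (Fin 3)) :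
    (LinearIsometryEquiv.piLpCongrLeft 2 ℝ ℝ (Equiv.swap (0 : Fin 3) 2) w) 0 = w 2 := by
  simp [LinearIsometryEquiv.piLpCongrLeft_apply, Equiv.piCongrLeft'_apply, Equiv.symm_swap]

/-- The coordinate swap `x₀ ↔ x₂` of `ℝ³` in coordinates: `(P w)₁ = w₁`. [folklore] -/
@[simp] theorem swap_apply_one (w : EuclideanSpace ℝ (Fin 3)) :
    (LinearIsometryEquiv.piLpCongrLeft 2 ℝ ℝ (Equiv.swap (0 : Fin 3) 2) w) 1 = w 1 := by
  simp [LinearIsometryEquiv.piLpCongrLeft_apply, Equiv.piCongrLeft'_apply, Equiv.symm_swap,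
    Equiv.swap_apply_of_ne_of_ne]

/-- The coordinate swap `x₀ ↔ x₂` of `ℝ³` in coordinates: `(P w)₂ = w₀`. [folklore] -/
@[simp] theorem swap_apply_two (w : EuclideanSpace ℝ (Fin 3)) :
    (LinearIsometryEquiv.piLpCongrLeft 2 ℝ ℝ (Equiv.swap (0 : Fin 3) 2) w) 2 = w 0 := by
  simp [LinearIsometryEquiv.piLpCongrLeft_apply, Equiv.piCongrLeft'_apply, Equiv.symm_swap]

/-- The test pair `(e₀, 2 e₀)` on the `e₀`-axis is non-coincident. [folklore] -/
theorem axisPair_mem :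
    (fun i : Fin 2 => (((i : ℕ) : ℝ) + 1) • EuclideanSpace.single (0 : Fin 3) (1 : ℝ)) ∈
      NonCoincident 3 2 := by
  intro i j hij
  have h0 := congrArg (fun w : EuclideanSpace ℝ (Fin 3) => w 0) hij
  simp only [PiLp.smul_apply, PiLp.single_apply, smul_eq_mul] at h0
  simp at h0
  exact Fin.ext h0

/-- **The conjugated quarter turn.**  For `v ≠ 0` there is a linear map `A` of `ℝ³` — namely
`A_v (z₀, z₁, z₂) = (-v z₂, z₁, z₀ / v)`, i.e. `A_v = D⁻¹ R D` with `D = diag(1,1,v)` and `R : e₀ ↦ e₂ ↦ -e₀`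
the quarter turn of the `(0,2)`-plane — which (i) preserves the quadratic form
`Q_v(z) = z₀² + z₁² + v² z₂²`, and (ii) composed as `A ∘ P ∘ A ∘ P` with the coordinate swap `P : x₀ ↔ x₂`
(the composite is `diag(v², 1, v⁻²)`) dilates the test pair `(e₀, 2e₀)` by `v²`. [folklore] -/
theorem quarterTurn_spec (v : ℝ) (hv : v ≠ 0) :
    ∃ A : EuclideanSpace ℝ (Fin 3) →ₗ[ℝ] EuclideanSpace ℝ (Fin 3),
      (∀ z : EuclideanSpace ℝ (Fin 3),
        (A z) 0 ^ 2 + (A z) 1 ^ 2 + v ^ 2 * (A z) 2 ^ 2 = z 0 ^ 2 + z 1 ^ 2 + v ^ 2 * z 2 ^ 2) ∧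
      (fun i : Fin 2 => A (LinearIsometryEquiv.piLpCongrLeft 2 ℝ ℝ (Equiv.swap (0 : Fin 3) 2)
          (A (LinearIsometryEquiv.piLpCongrLeft 2 ℝ ℝ (Equiv.swap (0 : Fin 3) 2)
            ((((i : ℕ) : ℝ) + 1) • EuclideanSpace.single (0 : Fin 3) (1 : ℝ)))))) =
        fun i : Fin 2 => (v ^ 2) • ((((i : ℕ) : ℝ) + 1) • EuclideanSpace.single (0 : Fin 3) (1 : ℝ)) := by
  refine ⟨Matrix.toEuclideanLin !![(0 : ℝ), 0, -v; 0, 1, 0; v⁻¹, 0, 0], fun z => ?_, ?_⟩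
  · rw [quarterTurn_apply_zero, quarterTurn_apply_one, quarterTurn_apply_two]
    field_simp
    ring
  · funext i
    ext j
    fin_cases j <;> simp
    ring

/-! ### The theorem -/

/-- **(V) Ellipsoid to sphere** (route ModularBoosts, item stmt-CriticalPhenomena-5432): if
`S : CorrFamily 3` has positive two-point function on `NonCoincident 3 2`, is scale covariant with
`Δ > 0`, and every `S n` is invariant under the coordinate swap `x₀ ↔ x₂` and under every linear map
preserving `Q_v = x₀² + x₁² + v² x₂²` (`v > 0`), then `IsRotationInvariant S`.  The composite
`A_v P A_v P` of the `Q_v`-orthogonal conjugated quarter turn `A_v` and the swap `P` dilates the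
non-coincident pair `(e₀, 2e₀)` by `v²`, so scale covariance and positivity force `(v²)^(-2Δ) = 1`, i.e.
`v = 1`; and `O(Q_1) = O(3)` (every linear isometry preserves `‖·‖² = Q_1`).
[cite: FrancescoMathieuSenechal1997, §4.3.1 eq. (4.62)] -/
theorem ellipsoidToSphere_proof : EllipsoidToSphere := by
  intro Δ v S hΔ hv hnd hsc hP hQ
  -- the `Q_v`-orthogonal map `A_v`; every `S n` is `A_v`-invariant
  obtain ⟨A, hAQ, hAcomp⟩ := quarterTurn_spec v hv.ne'
  have hA : ∀ (n : ℕ) (x : Fin n → EuclideanSpace ℝ (Fin 3)), S n (fun i => A (x i)) = S n x :=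
    fun n => hQ n A hAQ
  -- hence `S 2` is invariant under the composite `M = A_v P A_v P` on the test pair `(e₀, 2e₀)`
  have hM : S 2 (fun i : Fin 2 => A (LinearIsometryEquiv.piLpCongrLeft 2 ℝ ℝ (Equiv.swap (0 : Fin 3) 2)
      (A (LinearIsometryEquiv.piLpCongrLeft 2 ℝ ℝ (Equiv.swap (0 : Fin 3) 2)
        ((((i : ℕ) : ℝ) + 1) • EuclideanSpace.single (0 : Fin 3) (1 : ℝ)))))) =
      S 2 (fun i : Fin 2 => (((i : ℕ) : ℝ) + 1) • EuclideanSpace.single (0 : Fin 3) (1 : ℝ)) :=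
    ((hA 2 _).trans (hP 2 _)).trans ((hA 2 _).trans (hP 2 _))
  -- `M` dilates the test pair by `v²`: scale covariance
  obtain ⟨μ, hμdef, hscale⟩ : ∃ μ : ℝ, μ = (v ^ 2) ^ (-((2 : ℕ) : ℝ) * Δ) ∧
      S 2 (fun i : Fin 2 => (v ^ 2) • ((((i : ℕ) : ℝ) + 1) • EuclideanSpace.single (0 : Fin 3) (1 : ℝ))) =
        μ * S 2 (fun i : Fin 2 => (((i : ℕ) : ℝ) + 1) • EuclideanSpace.single (0 : Fin 3) (1 : ℝ)) :=
    ⟨_, rfl, hsc 2 (v ^ 2) (by positivity) _⟩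
  rw [hAcomp] at hM
  rw [hM] at hscale
  -- positivity of the two-point function: `μ = 1`
  have hpos : 0 < S 2 (fun i : Fin 2 => (((i : ℕ) : ℝ) + 1) • EuclideanSpace.single (0 : Fin 3) (1 : ℝ)) :=
    hnd _ axisPair_mem
  have hμ1 : μ = 1 := (mul_eq_right₀ hpos.ne').mp hscale.symm
  -- `Δ > 0`: `v² = 1`, `v = 1`
  have hexp : -((2 : ℕ) : ℝ) * Δ ≠ 0 := mul_ne_zero (by norm_num) hΔ.ne'
  have hv2 : v ^ 2 = 1 := by
    refine Real.rpow_left_injOn hexp (sq_nonneg v) (zero_le_one (α := ℝ)) ?_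
    show (v ^ 2) ^ (-((2 : ℕ) : ℝ) * Δ) = (1 : ℝ) ^ (-((2 : ℕ) : ℝ) * Δ)
    rw [Real.one_rpow, ← hμdef, hμ1]
  have hv1 : v = 1 := (pow_eq_one_iff_of_nonneg hv.le two_ne_zero).mp hv2
  subst hv1
  -- `v = 1`: every linear isometry preserves `Q_1 = ‖·‖²`
  intro n R x
  refine hQ n R.toLinearEquiv.toLinearMap (fun z => ?_) x
  have h1 : ‖R z‖ ^ 2 = ‖z‖ ^ 2 := by rw [LinearIsometryEquiv.norm_map]
  rw [EuclideanSpace.real_norm_sq_eq, EuclideanSpace.real_norm_sq_eq, Fin.sum_univ_three,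
    Fin.sum_univ_three] at h1
  simp only [LinearEquiv.coe_coe, LinearIsometryEquiv.coe_toLinearEquiv, one_pow, one_mul]
  linarith

end Summit.CriticalPhenomena.Ising3DConformalLimit.ModularBoostsSpeed

end
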